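import Summits.CriticalPhenomena.PercolationContinuityZ3.Theorems.Transplant.BoxProdZdTubes
import Summits.CriticalPhenomena.PercolationContinuityZ3.Theorems.Transplant.FreeNilpotentColumnConnected
import HarnessLib

/-!
# `N_{m,2} × ℤ` IS A SINGLE-TYPE CUSTOMER OF THE D″ v2 NODE for every rank `m ≥ 2`: the free 2-step nilpotent Cayley graph `Cay(N_{m,2})`
# carries a ONE-type one-dimensional reflectable skeleton (height = one abelianisation coordinate), so `SamePDropOfSkeletonSign₁ →
# θ_{Cay(N_{m,2}) □ ℤ}(v, p_c) = 0` — with Φ2 discharged by the tube theorem (no transverse coordinate)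

builds on p205010 (kernel theorem, internal audit signed; external expert review pending) — nothing in this file uses p205010.
Lane `prim-bschramm`, seat `prim-bschramm-p4` (gen 8; PART C3, METHOD = abstract closing argument); helper file (`--supports stmt-CriticalPhenomena-4575
--as helper`).  Memo: `HOME/bschramm/P4-GENERAL.md` §22.  Side-on series: `LineSkeletonSign`, `LineSkeletonSignCyl`, `BoxProdZdTubes`.

THE POINT.  In the class map (P4-GENERAL §12) the free 2-step nilpotent groups `N_{m,2}` (`m ≥ 3`) and all products `X □ N_{m,2}` — `ℤ □ N_{m,2}` among
them — were reachable only through the RANK-`m` conjecture node.  Side-on, `N_{m,2} × ℤ` needs much less: the height `ψ(v, c) = v_{i₀}` on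
`Cay(N_{m,2}; e_0, …, e_{m−1})` (tree: `fnGraph m` on `FN m`, Mal'cev coordinates) is 1-Lipschitz with unit steps `· e_{i₀}^{±1}`; the left translations
are ψ-translating frames (ONE type); the sign change `e_{i₀} ↦ e_{i₀}⁻¹` (`fnSignIso`, p4-g4) fixes `1` and reverses `ψ`; and the strips `{|v_{i₀}| ≤ ℓ}`
are connected although they are THICK (all other generators and the whole centre are free): inside `{|v_{i₀}| ≤ 1}` every level-`0` vertex is joined to
`1` — first straight segments along `e_j`, `j ≠ i₀` (they do not move `v_{i₀}`) down to the centre, then p4-g4's column walk in the column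
`fnCol j 1 ⊆ {|v_{i₀}| ≤ 1}` of a direction `j ≠ i₀` (`col_reach_snd`, commutator 4-cycles) — which is the criterion
`LineSkeletonNeg.induce_strip_connected_of_level`.  So `FNZ.line : LineSkeletonNeg (fnGraph m)` (`m ≥ 2`), and `BoxProdZdTubes` gives Φ2 at `p_c`
for `fnGraph m □ ℤ` (tubes are strictly subcritical): **`fnZ_criticalContinuity_of_signNode₁ : SamePDropOfSkeletonSign₁ → ∀ v, θ_{fnGraph m □ ℤ}(v, p_c) = 0`**
for every `m ≥ 2` — Benjamini–Schramm's Conjecture 4 for `N_{m,2} × ℤ` modulo the single-type node of record only (for `m = 2` this is `H₃(ℤ) × ℤ`,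
already unconditional in the tree by the node of record; for `m ≥ 3` it is new in the class map).
* §1 the strip set `FNZ.T1 i₀ = {|v_{i₀}| ≤ 1}`, segments along `e_j` (`j ≠ i₀`), `FNZ.reach_central_of_level`, `FNZ.level_reachable_zero`;
* §2 **`FNZ.line hm i₀ : LineSkeletonNeg (fnGraph m)`** (one type `{0}`);
* §3 **`fnZ_criticalContinuity_of_signNode₁`**, `fnZ_criticalContinuity_of_signNode`.
[cite: BenjaminiSchramm1996, Conj. 4; §2 (Cayley graphs)] [cite: KozmaNitzan2024, §4 p. 16 (Lemma 8: the symmetry x₁ ↦ −x₁)]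
[cite: ContrerasMartineauTassion2024, §1.1 (nilpotent Cayley graphs)] [cite: MartineauSevero2019, Cor. 2.2]
-/

noncomputable section

namespace Summit.CriticalPhenomena.PercolationContinuityZ3.Theorems.Transplant

namespace FNZ

open MeasureTheory Literature.Probability.Percolation Literature.Probability.LatticeModels SimpleGraph
open scoped Classical

variable {m : ℕ} {i₀ : Fin m}

/-! ## §1 The strip of half-width `1` in the direction `i₀` and the walk of a level-`0` vertex to `1` -/

/-- The strip `{|v_{i₀}| ≤ 1}`. [folklore] -/
abbrev T1 (i₀ : Fin m) : Set (FN m) := {x | |x.1 i₀| ≤ 1}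

/-- `1 ∈ T1`. [folklore] -/
theorem zero_mem_T1 (i₀ : Fin m) : (0 : FN m) ∈ T1 i₀ := by show |(0 : FN m).1 i₀| ≤ 1; simp

/-- A generator step that stays in the strip is an edge of the strip graph. [folklore] -/
theorem t1_step {u : FN m} (hu : u ∈ T1 i₀) {s : FN m} (hs : s ∈ fnGens m) (hv : fnMul u s ∈ T1 i₀) :
    ((fnGraph m).induce (T1 i₀)).Reachable ⟨u, hu⟩ ⟨fnMul u s, hv⟩ := by
  refine SimpleGraph.Adj.reachable ?_
  rw [SimpleGraph.comap_adj, Function.Embedding.coe_subtype]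
  exact fnGraph_adj_mul_gen u hs

/-- Transport of a reachability target along an equality of vertices. [folklore] -/
theorem t1_reach_of_eq {x : T1 i₀} {v v' : FN m} {hv : v ∈ T1 i₀} (h : v = v')
    (hr : ((fnGraph m).induce (T1 i₀)).Reachable x ⟨v, hv⟩) : ((fnGraph m).induce (T1 i₀)).Reachable x ⟨v', h ▸ hv⟩ := by
  subst h; exact hr

/-- Steps along `e_j`, `j ≠ i₀`, do not move `v_{i₀}`: they stay in the strip. [folklore] -/
theorem fnMul_kElt_mem_T1 {u : FN m} (hu : u ∈ T1 i₀) {j : Fin m} (hj : j ≠ i₀) (t : ℤ) : fnMul u (kElt j t 0) ∈ T1 i₀ := by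
  show |(fnMul u (kElt j t 0)).1 i₀| ≤ 1
  rw [fnMul_kElt_right_fst, if_neg (Ne.symm hj), add_zero]
  exact hu

/-- **Straight segments along `e_j`, `j ≠ i₀`, inside the strip.** [folklore] -/
theorem t1_reach_segment (u : FN m) (hu : u ∈ T1 i₀) {j : Fin m} (hj : j ≠ i₀) :
    ∀ t : ℤ, ((fnGraph m).induce (T1 i₀)).Reachable ⟨u, hu⟩ ⟨fnMul u (kElt j t 0), fnMul_kElt_mem_T1 hu hj t⟩ := by
  intro t
  induction t using Int.induction_on with
  | zero => exact t1_reach_of_eq (by rw [kElt_zero, fnMul_zero]) (Reachable.refl _)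
  | succ n ih =>
    have e : fnMul (fnMul u (kElt j (n : ℤ) 0)) (kElt j 1 0) = fnMul u (kElt j ((n : ℤ) + 1) 0) := by
      rw [fnMul_assoc, kElt_mul, add_zero]
    exact ih.trans (t1_reach_of_eq e (t1_step (fnMul_kElt_mem_T1 hu hj _) (kElt_mem_fnGens j (Or.inl rfl))
      (e ▸ fnMul_kElt_mem_T1 hu hj _)))
  | pred n ih =>
    have e : fnMul (fnMul u (kElt j (-(n : ℤ)) 0)) (kElt j (-1) 0) = fnMul u (kElt j (-(n : ℤ) - 1) 0) := by
      rw [fnMul_assoc, kElt_mul, add_zero, sub_eq_add_neg]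
    exact ih.trans (t1_reach_of_eq e (t1_step (fnMul_kElt_mem_T1 hu hj _) (kElt_mem_fnGens j (Or.inr rfl))
      (e ▸ fnMul_kElt_mem_T1 hu hj _)))

/-- Central elements lie in the strip. [folklore] -/
theorem central_mem_T1 (i₀ : Fin m) (c : Pr m → ℤ) : (((0 : Fin m → ℤ), c) : FN m) ∈ T1 i₀ := by
  show |(0 : Fin m → ℤ) i₀| ≤ 1; simp

/-- **From a vertex of the strip whose skeleton part is supported off `i₀`, the centre `{(0, c)}` is reachable inside the strip** (kill the
coordinates `j ≠ i₀` one at a time along `e_j`; `v_{i₀}` never moves). [folklore] -/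
theorem reach_central_of_support (S : Finset (Fin m)) (hS : i₀ ∉ S) :
    ∀ (w : FN m) (hw : w ∈ T1 i₀), (∀ i, i ∉ S → w.1 i = 0) →
      ∃ c : Pr m → ℤ, ((fnGraph m).induce (T1 i₀)).Reachable ⟨w, hw⟩ ⟨((0 : Fin m → ℤ), c), central_mem_T1 i₀ c⟩ := by
  induction S using Finset.induction_on with
  | empty =>
    intro w hw h0
    have hv : w.1 = 0 := funext fun i => h0 i (Finset.notMem_empty i)
    exact ⟨w.2, t1_reach_of_eq (hv := hw) (Prod.ext hv rfl : w = ((0 : Fin m → ℤ), w.2)) (Reachable.refl _)⟩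
  | insert j S hj ih =>
    intro w hw h0
    have hji : j ≠ i₀ := fun h => hS (by rw [← h]; exact Finset.mem_insert_self j S)
    have hS' : i₀ ∉ S := fun h => hS (Finset.mem_insert_of_mem h)
    -- kill the coordinate `j`
    set w' : FN m := fnMul w (kElt j (-(w.1 j)) 0) with hw'
    have hw'mem : w' ∈ T1 i₀ := fnMul_kElt_mem_T1 hw hji _
    have hsupp : ∀ i, i ∉ S → w'.1 i = 0 := by
      intro i hi
      rw [hw', fnMul_kElt_right_fst]
      by_cases hij : i = j
      · subst hij; simp
      · rw [if_neg hij, add_zero]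
        exact h0 i (by simp [hij, hi])
    obtain ⟨c, hr⟩ := ih hS' w' hw'mem hsupp
    exact ⟨c, (t1_reach_segment w hw hji (-(w.1 j))).trans hr⟩

/-- **Every vertex of the central level `{v_{i₀} = 0}` is joined to `1` inside the strip `{|v_{i₀}| ≤ 1}`** (`m ≥ 2`: segments to the centre, then
p4-g4's column walk inside `fnCol j 1 ⊆ {|v_{i₀}| ≤ 1}` for a direction `j ≠ i₀`). [folklore] -/
theorem level_reachable_zero (hm : 2 ≤ m) (i₀ : Fin m) (w : FN m) (hw : w ∈ T1 i₀) (h0 : w.1 i₀ = 0) :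
    ((fnGraph m).induce (T1 i₀)).Reachable ⟨w, hw⟩ ⟨0, zero_mem_T1 i₀⟩ := by
  -- to the centre
  obtain ⟨c, hr⟩ := reach_central_of_support (Finset.univ.erase i₀) (Finset.notMem_erase i₀ _) w hw (fun i hi => by
    have : i = i₀ := by simpa using hi
    rw [this, h0])
  refine hr.trans ?_
  -- a second direction `j ≠ i₀`
  obtain ⟨j, hj⟩ : ∃ j : Fin m, j ≠ i₀ := by
    by_cases h : (i₀ : ℕ) = 0
    · exact ⟨⟨1, by omega⟩, fun e => by have := congrArg Fin.val e; simp at this; omega⟩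
    · exact ⟨⟨0, by omega⟩, fun e => by have := congrArg Fin.val e; simp at this; omega⟩
  -- the column walk of p4-g4 in `fnCol j 1`, mapped into the strip
  have hsub : fnCol j 1 ⊆ T1 i₀ := fun x hx => by
    have := hx i₀ (Ne.symm hj); show |x.1 i₀| ≤ 1; exact_mod_cast this
  have hc1 : (((0 : Fin m → ℤ), c) : FN m) ∈ fnCol j 1 := fun i _ => by simp
  have hz : (0 : FN m) ∈ fnCol j 1 := zero_mem_fnCol j 1
  have hcol : (fnColGraph j 1).Reachable ⟨((0 : Fin m → ℤ), c), hc1⟩ ⟨0, hz⟩ := by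
    have h := col_reach_snd (i₀ := j) (L := 1) le_rfl (0 : Fin m → ℤ) (fun i _ => by simp) c 0
    exact h
  exact hcol.map (induceHomOfLE (fnGraph m) hsub).toHom

/-! ## §2 The one-dimensional reflectable skeleton of `Cay(N_{m,2})` -/

/-- The sign pattern flipping the generator `e_{i₀}` only. [folklore] -/
def flipSign (i₀ : Fin m) : Fin m → ℤˣ := fun i => if i = i₀ then -1 else 1

/-- `flipSign i₀ i₀ = −1`. [folklore] -/
@[simp] theorem flipSign_self (i₀ : Fin m) : flipSign i₀ i₀ = -1 := by simp [flipSign]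

/-- Degree bound: every vertex of `Cay(N_{m,2})` has at most `|S|` neighbours. [folklore] -/
theorem degree_le_card_fnGens (x : FN m) : (fnGraph m).degree x ≤ (fnGens m).card := by
  have h : (fnGraph m).neighborFinset x = (fnGens m).image (fnMul x) := by
    apply Finset.coe_injective
    rw [SimpleGraph.coe_neighborFinset, neighborSet_fnGraph]
  rw [← SimpleGraph.card_neighborFinset_eq_degree, h]
  exact Finset.card_image_le

/-- **`Cay(N_{m,2})` CARRIES A ONE-TYPE ONE-DIMENSIONAL REFLECTABLE SKELETON** (`m ≥ 2`): height `v_{i₀}`, base vertex `1`, frames = left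
translations, reflection = the sign change of `e_{i₀}`, degree `≤ |S|`, unit steps `· e_{i₀}^{±1}`, connected (thick) strips.
[cite: KozmaNitzan2024, §4 p. 16 (Lemma 8)] [cite: BenjaminiSchramm1996, §2] -/
def line (hm : 2 ≤ m) (i₀ : Fin m) : LineSkeletonNeg (fnGraph m) where
  ψ := fun x => x.1 i₀
  lip := by
    intro u v h
    obtain ⟨i, hi | hi⟩ := fnGraph_adj_fst u v h
    · rw [hi, Pi.add_apply, Pi.single_apply]; split_ifs <;> simp
    · rw [hi, Pi.sub_apply, Pi.single_apply]; split_ifs <;> simp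
  types := {0}
  frame := fun v => ⟨0, Finset.mem_singleton_self 0, fnLeftIso v, by rw [fnLeftIso_apply, fnMul_zero], fun w => by
    rw [fnLeftIso_apply, fnMul_fst, Pi.add_apply]; simp; ring⟩
  neg := by
    intro t ht
    rw [Finset.mem_singleton] at ht
    subst ht
    refine ⟨fnSignIso (flipSign i₀), ?_, fun w => ?_⟩
    · rw [fnSignIso_apply]; exact Prod.ext (funext fun i => by simp) (funext fun q => by simp)
    · rw [fnSignIso_apply, signMap_fst, flipSign_self]; simp
  Δ := (fnGens m).card
  degree_le := degree_le_card_fnGens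
  step := by
    intro v σ
    rcases Int.units_eq_one_or σ with rfl | rfl
    · exact ⟨fnMul v (fnGen i₀), fnGraph_adj_mul_gen v (fnGen_mem_fnGens i₀), by simp⟩
    · exact ⟨fnMul v (fnGenInv i₀), fnGraph_adj_mul_gen v (fnGenInv_mem_fnGens i₀), by simp⟩
  strip_connected := by
    intro t ht ℓ hℓ
    rw [Finset.mem_singleton] at ht
    subst ht
    refine LineSkeletonNeg.induce_strip_connected_of_level (fun x : FN m => x.1 i₀)
      (fun v σ => ?_) 0 (fun w hw hψ => ?_) ℓ hℓ
    · rcases Int.units_eq_one_or σ with rfl | rfl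
      · exact ⟨fnMul v (fnGen i₀), fnGraph_adj_mul_gen v (fnGen_mem_fnGens i₀), by simp⟩
      · exact ⟨fnMul v (fnGenInv i₀), fnGraph_adj_mul_gen v (fnGenInv_mem_fnGens i₀), by simp⟩
    · have hsub : T1 i₀ ⊆ {u : FN m | |u.1 i₀ - (0 : FN m).1 i₀| ≤ ((1 : ℕ) : ℤ)} := fun u hu => by simpa using hu
      have hwT : w ∈ T1 i₀ := by have := hw; simpa using this
      have h0 : w.1 i₀ = 0 := by simpa using hψ
      exact (level_reachable_zero hm i₀ w hwT h0).map (induceHomOfLE (fnGraph m) hsub).toHom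

/-- The height of `line`. [folklore] -/
@[simp] theorem line_ψ (hm : 2 ≤ m) (i₀ : Fin m) (x : FN m) : (line hm i₀).ψ x = x.1 i₀ := rfl

/-- The base vertex of `line`. [folklore] -/
theorem line_types (hm : 2 ≤ m) (i₀ : Fin m) : (line hm i₀).types = {0} := rfl

end FNZ

/-! ## §3 The conditional theorems for `N_{m,2} × ℤ` -/

open MeasureTheory Literature.Probability.Percolation Literature.Probability.LatticeModels SimpleGraph
open scoped Classical

/-- **THEOREM (node of record): `SamePDropOfSkeletonSign₁ → θ_{Cay(N_{m,2}) □ ℤ}(v, p_c) = 0` at every vertex, for every rank `m ≥ 2`** —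
`N_{m,2} × ℤ` is a SINGLE-TYPE D″ customer through the side-on skeleton `(v_0, t)`, Φ2 at `p_c` by the tube theorem (no transverse coordinate).
[cite: BenjaminiSchramm1996, Conj. 4] [cite: ContrerasMartineauTassion2024, §1.1] [cite: MartineauSevero2019, Cor. 2.2] -/
theorem fnZ_criticalContinuity_of_signNode₁ (hD : SamePDropOfSkeletonSign₁) {m : ℕ} (hm : 2 ≤ m) (v : FN m × Site 1) :
    theta (fnGraph m □ zdGraph 1) v (criticalProbIOf (fnGraph m □ zdGraph 1) v) = 0 :=
  (FNZ.line hm ⟨0, by omega⟩).prodInt_criticalContinuity_of_signNode₁' hD (FNZ.line_types hm _) v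

/-- **… and from the multi-type node** (a fortiori). [cite: BenjaminiSchramm1996, Conj. 4] -/
theorem fnZ_criticalContinuity_of_signNode (hD : SamePDropOfSkeletonSign) {m : ℕ} (hm : 2 ≤ m) (v : FN m × Site 1) :
    theta (fnGraph m □ zdGraph 1) v (criticalProbIOf (fnGraph m □ zdGraph 1) v) = 0 :=
  fnZ_criticalContinuity_of_signNode₁ (samePDropOfSkeletonSign₁_of_sign hD) hm v

end Summit.CriticalPhenomena.PercolationContinuityZ3.Theorems.Transplant

end
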